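import Mathlib

/-!
# Route BarrierLever — item 20172 (CPM), benchmark row 14: the MOORE–CHOW BENCHMARK FOR PAIR ROWS
# and the objects of the HIERARCHICAL MOORE PEEL (definitions)

Helper file (`--supports stmt-ValiantsHypothesis-20172`; cell valiant-natproofs, rung V4, 𝒟-side of
door (c), benchmark «row 14» of the director's round-3 table; seat valiant-natproofs-prover gen 14,
typing planner p1 g18's memo `HOME/p1/g18/MEMO-g18.md` §§1–2 and the signature preview
`HOME/p1/g18/MoorePeel_SigPreview.lean`).  Closes NO item.  DEFINITIONS ONLY (plus their immediate
API); the theorems live in the companion files `…MooreBench*`.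

Conventions of items 19717 / 20172 / 20195: in `MvPolynomial (Fin (h+h)) R`, `x_a = X (castAdd h a)`,
`y_c = X (natAdd h c)`; the partition exponent of a layout cell `(U, W)` is
`E U W = Σ_{a∈U} single (castAdd h a) 1 + Σ_{c∈W} single (natAdd h c) 1`.

* `benchCols h r j` — column `j < r` of the benchmark = the binary digits of `j` inside `Fin h`;
  `mooreChowFactor h Y a = x_a + 1 + Σ_c Y_a^(2^c) y_c` — the Moore–Chow design (an x-private product
  of `h` affine forms); `MCBenchPairsAt h` — **MC-bench(s = 2) at height `h`**: for every injective
  enumeration `u` of ALL row sets of size `≤ 2`, some node table `Y : Fin h → ℂ` makes the partition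
  minor `[coeff_{E (u i) (benchCols j)} ∏_a mooreChowFactor h Y a]_{i j}` nonsingular.
* `popcount`, `windowStart i = c_i = 1 + i(i-1)/2`, `peelMatrix i = G_i`,
  `G_i[j, m] = |T_{c_i+m} ∖ T_j|! · [T_j ⊆ T_{c_i+m}]` (`j, m < i`; integers read as bit-sets `T`) —
  the stage-`i` matrix of the hierarchical Moore peel (memo §2.3); Theorem A of the memo is
  `(∀ i ∈ [1,h], det G_i ≠ 0) → MCBenchPairsAt h` (file `…MooreBenchPeel`).
* Peel bookkeeping: `bits n` / `bin s` (codes ↔ finite sets of naturals, `Finset.equivBitIndices`),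
  `RowLabel`, `rowVec r Y` — the three kinds of labelled rows of the peel as vectors on the codes
  `< r` over a node table `Y : ℕ → R`:
  monomial rows `e_m`, attached one-point rows `(T_j, {b}) ↦ [T_j ⊆ T] · |T ∖ T_j|! · Y_b^{bin (T∖T_j)}`,
  and pair rows `(∅, {b, b'}) ↦ Σ_{d ⊆ T} |T∖d|! Y_b^{bin(T∖d)} · |d|! Y_{b'}^{bin d}` (the unsigned
  rows `∅`, `{b}`, `{b,b'}` of the truncated-inverse matrix `Θ̂` of `…ChowCubeThetaHat`, up to the
  column sign `(-1)^{|T|}`); `stageRows i n` — the labels alive before stage `i` when `n` points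
  remain; `nodeY h` — the symbolic node table `b ↦ X b` in `MvPolynomial (Fin h) ℂ`.

WHAT THIS IS NOT: definitions for a finite-height BENCHMARK of item 20172 and its certificate calculus;
no statement about 20172 / 20195 / 19717 themselves, nothing on crux stmt-ValiantsHypothesis-14610 or on
`VP` versus `VNP`.
-/

set_option linter.dupNamespace false

namespace Summit.ValiantsHypothesis.ValiantsHypothesis.Theorems.BarrierLever.MoorePeel

open MvPolynomial Finset

/-! ## 1. The benchmark (preview `MoorePeel_SigPreview.lean`, verbatim) -/

/-- Column `j < r` of the benchmark: the binary digits of `j` as a subset of `Fin h`. -/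
def benchCols (h r : ℕ) (j : Fin r) : Finset (Fin h) :=
  Finset.univ.filter fun c => Nat.testBit (j : ℕ) (c : ℕ)

/-- The `a`-th Moore–Chow factor `x_a + 1 + Σ_c Y_a^(2^c) y_c`. -/
noncomputable def mooreChowFactor (h : ℕ) (Y : Fin h → ℂ) (a : Fin h) :
    MvPolynomial (Fin (h + h)) ℂ :=
  X (Fin.castAdd h a) + 1 + ∑ c : Fin h, C (Y a ^ 2 ^ (c : ℕ)) * X (Fin.natAdd h c)

/-- **MC-bench(s = 2) at ONE height `h`**: rows = exactly the sets of size `≤ 2` (any injective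
enumeration), columns = the first `r` binary codes; some node table `Y` makes the partition minor of
the Moore–Chow design `∏_a mooreChowFactor h Y a` nonsingular. -/
def MCBenchPairsAt (h : ℕ) : Prop :=
  ∀ (r : ℕ) (u : Fin r → Finset (Fin h)),
    Function.Injective u → (∀ i, (u i).card ≤ 2) →
    (∀ S : Finset (Fin h), S.card ≤ 2 → ∃ i, u i = S) →
    ∃ Y : Fin h → ℂ,
      (Matrix.of fun i j : Fin r => MvPolynomial.coeff
        (∑ a ∈ u i, Finsupp.single (Fin.castAdd h a) 1 +
          ∑ c ∈ benchCols h r j, Finsupp.single (Fin.natAdd h c) 1)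
        (∏ a : Fin h, mooreChowFactor h Y a)).det ≠ 0

/-- Number of binary digits equal to `1`. -/
def popcount (n : ℕ) : ℕ := (Nat.bitIndices n).length

/-- First code of the stage-`i` window: `c_i = 1 + i(i-1)/2`
(the number of monomials fixed before stage `i`; `c_{h+1} = 1 + h + C(h,2)` is the benchmark size). -/
def windowStart (i : ℕ) : ℕ := 1 + i * (i - 1) / 2

/-- The stage-`i` peel matrix `G_i[j, m] = |T_{c_i+m} ∖ T_j|! · [T_j ⊆ T_{c_i+m}]`
(`j < i`, `m < i`; naturals read as bit-sets). -/
def peelMatrix (i : ℕ) : Matrix (Fin i) (Fin i) ℤ :=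
  Matrix.of fun j m =>
    if (j : ℕ) &&& (windowStart i + (m : ℕ)) = (j : ℕ)
    then ((popcount (windowStart i + (m : ℕ)) - popcount (j : ℕ)).factorial : ℤ)
    else 0

/-! ## 2. Codes and bit-sets -/

/-- The binary digits of `n` as a finite set of naturals (`Finset.equivBitIndices`). -/
def bits (n : ℕ) : Finset ℕ := n.bitIndices.toFinset

/-- The code `Σ_{i ∈ s} 2^i` of a finite set of naturals. -/
def bin (s : Finset ℕ) : ℕ := ∑ i ∈ s, 2 ^ i

/-- `bits (bin s) = s`. -/
@[simp] theorem bits_bin (s : Finset ℕ) : bits (bin s) = s :=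
  Finset.toFinset_bitIndices_sum_two_pow s

/-- `bin (bits n) = n`. -/
@[simp] theorem bin_bits (n : ℕ) : bin (bits n) = n :=
  Finset.sum_toFinset_bitIndices_two_pow n

/-- `bits` is injective. -/
theorem bits_injective : Function.Injective bits :=
  fun m n e => by rw [← bin_bits m, ← bin_bits n, e]

/-- `bin` is injective. -/
theorem bin_injective : Function.Injective bin :=
  fun s t e => by rw [← bits_bin s, ← bits_bin t, e]

/-- Membership in `bits n` is the binary digit test. -/
theorem mem_bits {c n : ℕ} : c ∈ bits n ↔ n.testBit c = true := by
  rw [bits, List.mem_toFinset, Nat.mem_bitIndices]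

/-- `bits 0 = ∅`. -/
@[simp] theorem bits_zero : bits 0 = ∅ := by
  simp [bits]

/-- `|bits n| = popcount n`. -/
theorem card_bits (n : ℕ) : (bits n).card = popcount n :=
  List.toFinset_card_of_nodup Nat.bitIndices_nodup

/-- Containment of bit-sets is the bitwise test `j &&& m = j`. -/
theorem bits_subset_bits_iff {j m : ℕ} : bits j ⊆ bits m ↔ j &&& m = j := by
  constructor
  · intro hsub
    refine Nat.eq_of_testBit_eq fun c => ?_
    rw [Nat.testBit_land]
    by_cases hj : j.testBit c = true
    · rw [hj, Bool.true_and]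
      exact mem_bits.mp (hsub (mem_bits.mpr hj))
    · rw [Bool.not_eq_true] at hj
      rw [hj, Bool.false_and]
  · intro e c hc
    rw [mem_bits] at hc ⊢
    rw [← e, Nat.testBit_land, Bool.and_eq_true] at hc
    exact hc.2

/-- A digit of a number `< 2^h` is `< h`. -/
theorem lt_of_mem_bits {c n h : ℕ} (hn : n < 2 ^ h) (hc : c ∈ bits n) : c < h := by
  by_contra hch
  have h2 : n < 2 ^ c := lt_of_lt_of_le hn (Nat.pow_le_pow_right (by norm_num) (not_lt.mp hch))
  have := Nat.testBit_eq_false_of_lt h2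
  rw [mem_bits.mp hc] at this
  exact Bool.noConfusion this

/-- The benchmark column `benchCols h r j` consists of the digits of `j` (read in `Fin h`). -/
theorem mem_benchCols {h r : ℕ} {j : Fin r} {c : Fin h} :
    c ∈ benchCols h r j ↔ (c : ℕ) ∈ bits (j : ℕ) := by
  rw [benchCols, Finset.mem_filter, mem_bits]
  simp

/-- For `j < 2^h`, the benchmark column maps onto `bits j` under `Fin.val`. -/
theorem map_benchCols {h r : ℕ} (j : Fin r) (hj : (j : ℕ) < 2 ^ h) :
    (benchCols h r j).map Fin.valEmbedding = bits (j : ℕ) := by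
  ext c
  rw [Finset.mem_map]
  constructor
  · rintro ⟨c', hc', rfl⟩
    exact mem_benchCols.mp hc'
  · intro hc
    exact ⟨⟨c, lt_of_mem_bits hj hc⟩, mem_benchCols.mpr hc, rfl⟩

/-- The entries of the peel matrix in terms of bit-sets:
`G_i[j, m] = [bits j ⊆ bits (c_i + m)] · (|bits (c_i+m)| - |bits j|)!`. -/
theorem peelMatrix_apply (i : ℕ) (j m : Fin i) :
    peelMatrix i j m = if bits (j : ℕ) ⊆ bits (windowStart i + (m : ℕ))
      then (((bits (windowStart i + (m : ℕ))).card - (bits (j : ℕ)).card).factorial : ℤ) else 0 := by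
  rw [peelMatrix, Matrix.of_apply, card_bits, card_bits]
  by_cases hsub : bits (j : ℕ) ⊆ bits (windowStart i + (m : ℕ))
  · rw [if_pos (bits_subset_bits_iff.mp hsub), if_pos hsub]
  · rw [if_neg (fun e => hsub (bits_subset_bits_iff.mpr e)), if_neg hsub]

/-! ## 3. The window arithmetic -/

/-- `c_{i+1} = c_i + i`. -/
theorem windowStart_succ (i : ℕ) : windowStart (i + 1) = windowStart i + i := by
  unfold windowStart
  rcases Nat.eq_zero_or_pos i with rfl | hi
  · simp
  · obtain ⟨k, rfl⟩ : ∃ k, i = k + 1 := ⟨i - 1, by omega⟩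
    have e : (k + 1 + 1) * (k + 1 + 1 - 1) = (k + 1) * (k + 1 - 1) + 2 * (k + 1) := by
      rw [Nat.add_sub_cancel, Nat.add_sub_cancel]
      ring
    rw [e, Nat.add_mul_div_left _ _ (by norm_num : 0 < 2)]
    ring

/-- `c_1 = 1`. -/
@[simp] theorem windowStart_one : windowStart 1 = 1 := by
  simp [windowStart]

/-- `c_{h+1} = 1 + h + C(h, 2)` — the number of sets of size `≤ 2` in `Fin h`. -/
theorem windowStart_succ_eq_choose (h : ℕ) : windowStart (h + 1) = 1 + h + h.choose 2 := by
  rw [windowStart, Nat.choose_two_right, Nat.add_sub_cancel]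
  rcases Nat.eq_zero_or_pos h with rfl | hh
  · simp
  · obtain ⟨k, rfl⟩ : ∃ k, h = k + 1 := ⟨h - 1, by omega⟩
    have e : (k + 1 + 1) * (k + 1) = (k + 1) * (k + 1 - 1) + 2 * (k + 1) := by
      rw [Nat.add_sub_cancel]
      ring
    rw [e, Nat.add_mul_div_left _ _ (by norm_num : 0 < 2)]
    ring

/-- `c_{h+1} ≤ 2^h`: every benchmark code has its digits inside `Fin h`. -/
theorem windowStart_succ_le_two_pow (h : ℕ) : windowStart (h + 1) ≤ 2 ^ h := by
  rw [windowStart_succ_eq_choose]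
  rcases Nat.lt_or_ge h 2 with hlt | hge
  · interval_cases h <;> simp
  · rw [← Nat.sum_range_choose h]
    have h3 : Finset.range 3 ⊆ Finset.range (h + 1) := Finset.range_subset_range.mpr (by omega)
    calc 1 + h + h.choose 2 = ∑ m ∈ Finset.range 3, h.choose m := by
            simp [Finset.sum_range_succ, Nat.choose_zero_right, Nat.choose_one_right]
      _ ≤ ∑ m ∈ Finset.range (h + 1), h.choose m :=
            Finset.sum_le_sum_of_subset_of_nonneg h3 fun _ _ _ => Nat.zero_le _

/-! ## 4. Labelled rows of the peel -/

/-- Row labels of the peel: a monomial row `e_m` (`inl m`), an attached one-point row `(T_j, {b})`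
(`inr (inl (j, b))`), or a pair row `(∅, {b, b'})` (`inr (inr (b, b'))`). -/
abbrev RowLabel : Type := ℕ ⊕ (ℕ × ℕ) ⊕ (ℕ × ℕ)

/-- **The labelled rows as vectors on the codes `< r`** over a node table `Y : ℕ → R`
(unsigned rows of `Θ̂`, memo §2.1): `e_m`; `(T_j,{b}) ↦ [T_j ⊆ T]·|T∖T_j|!·Y_b^{bin(T∖T_j)}`;
`(∅,{b,b'}) ↦ Σ_{d⊆T} |T∖d|!·Y_b^{bin(T∖d)} · |d|!·Y_{b'}^{bin d}` (`T = bits col`). -/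
def rowVec {R : Type*} [CommRing R] (r : ℕ) (Y : ℕ → R) : RowLabel → (Fin r → R)
  | Sum.inl m => fun col => if (col : ℕ) = m then 1 else 0
  | Sum.inr (Sum.inl (j, b)) => fun col => if bits j ⊆ bits (col : ℕ) then
      (((bits (col : ℕ)).card - (bits j).card).factorial : R) * Y b ^ bin (bits (col : ℕ) \ bits j)
      else 0
  | Sum.inr (Sum.inr (b, b')) => fun col => ∑ d ∈ (bits (col : ℕ)).powerset,
      (((bits (col : ℕ) \ d).card.factorial : R) * Y b ^ bin (bits (col : ℕ) \ d)) *
        ((d.card.factorial : R) * Y b' ^ bin d)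

/-- **The labels alive before stage `i` when `n` points remain** (memo §2.3): the monomials
`T_m`, `m < c_i`; the attached rows `(T_j, {b})`, `j < i`, `b < n`; the pair rows `(∅, {b, b'})`,
`b < b' < n`. -/
def stageRows (i n : ℕ) : Finset RowLabel :=
  (Finset.range (windowStart i)).image (fun m => (Sum.inl m : RowLabel)) ∪
  ((Finset.range i ×ˢ Finset.range n).image fun p => (Sum.inr (Sum.inl p) : RowLabel)) ∪
  (((Finset.range n ×ˢ Finset.range n).filter fun p => p.1 < p.2).image
    fun p => (Sum.inr (Sum.inr p) : RowLabel))

/-- The symbolic node table `b ↦ X b` (and `0` beyond `h`) in `MvPolynomial (Fin h) ℂ`. -/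
noncomputable def nodeY (h : ℕ) (b : ℕ) : MvPolynomial (Fin h) ℂ :=
  if hb : b < h then X ⟨b, hb⟩ else 0

/-- Membership in `stageRows`, monomial labels. -/
@[simp] theorem inl_mem_stageRows {i n m : ℕ} :
    (Sum.inl m : RowLabel) ∈ stageRows i n ↔ m < windowStart i := by
  simp [stageRows]

/-- Membership in `stageRows`, attached one-point labels. -/
@[simp] theorem inr_inl_mem_stageRows {i n j b : ℕ} :
    (Sum.inr (Sum.inl (j, b)) : RowLabel) ∈ stageRows i n ↔ j < i ∧ b < n := by
  simp [stageRows]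

/-- Membership in `stageRows`, pair labels. -/
@[simp] theorem inr_inr_mem_stageRows {i n b b' : ℕ} :
    (Sum.inr (Sum.inr (b, b')) : RowLabel) ∈ stageRows i n ↔ b < b' ∧ b' < n := by
  simp only [stageRows, Finset.mem_union, Finset.mem_image, Finset.mem_range, Finset.mem_filter,
    Finset.mem_product, reduceCtorEq, and_false, exists_false, Sum.inr.injEq,
    false_or, Prod.exists, Prod.mk.injEq]
  constructor
  · rintro ⟨x, y, ⟨⟨-, hy⟩, hxy⟩, rfl, rfl⟩
    exact ⟨hxy, hy⟩
  · rintro ⟨hbb, hb'⟩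
    exact ⟨b, b', ⟨⟨lt_trans hbb hb', hb'⟩, hbb⟩, rfl, rfl⟩

/-- Ring homomorphisms act on the rows through the node table. -/
theorem map_rowVec {R S : Type*} [CommRing R] [CommRing S] (φ : R →+* S) (r : ℕ) (Y : ℕ → R)
    (x : RowLabel) (col : Fin r) : φ (rowVec r Y x col) = rowVec r (fun b => φ (Y b)) x col := by
  rcases x with m | ⟨j, b⟩ | ⟨b, b'⟩
  · simp only [rowVec]
    split_ifs <;> simp
  · simp only [rowVec]
    split_ifs <;> simp
  · simp only [rowVec, map_sum, map_mul, map_natCast, map_pow]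

/-- A row only depends on the node table at its own points. -/
theorem rowVec_congr {R : Type*} [CommRing R] (r : ℕ) (Y Y₂ : ℕ → R) :
    ∀ x : RowLabel, (∀ b : ℕ, (match x with
      | Sum.inl _ => False
      | Sum.inr (Sum.inl (_, b₁)) => b = b₁
      | Sum.inr (Sum.inr (b₁, b₂)) => b = b₁ ∨ b = b₂) → Y b = Y₂ b) →
      rowVec r Y x = rowVec r Y₂ x := by
  rintro (m | ⟨j, b⟩ | ⟨b, b'⟩) hY
  · rfl
  · funext col
    simp only [rowVec, hY b rfl]
  · funext col
    simp only [rowVec, hY b (Or.inl rfl), hY b' (Or.inr rfl)]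

end Summit.ValiantsHypothesis.ValiantsHypothesis.Theorems.BarrierLever.MoorePeel
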